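import Literature.AlgebraicGeometry.Morphisms.ProperHigherDirectImagesAffine
import Literature.AlgebraicGeometry.Modules.BoundedCoherentVBModels
import Mathlib.AlgebraicGeometry.Noetherian
import HarnessLib

/-!
# Grothendieck's coherence of higher direct images (EGA III Thm. 3.2.1; Görtz–Wedhorn II Thm. 23.17;
# Hartshorne III Thm. 8.8 (b)) — the named fact `Grothendieck_higherDirectImage_coh` HOLDS (universe `u = 0`)

EGA III 3.2.1 / Görtz–Wedhorn II Thm. 23.17: for `f : X → Y` proper, `Y` locally noetherian and `𝓕` coherent, every
higher direct image `Rᵏf_*𝓕` is coherent. The tree's named fact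
`Modules/BoundedCoherentVBModels.Grothendieck_higherDirectImage_coh.{u, w, w'}` states it for the derived direct image
`derivedPushforwardPlus f : D⁺(Mod 𝒪_X) ⥤ D⁺(Mod 𝒪_Y)` (`Modules/DerivedPushforward`), Mathlib's cohomology-sheaf functors
on `D⁺` and the affine-local coherence predicate `Coh`. This file PROVES it at `u = 0` (every `w`, `w'`) — the
universe of both consumers in the tree (`AbelianVarieties/MarkmanDescendedTransformModel` at `.{0, v₄, v₅}`,
`Summits/…/VHCAbelianSchemesRoadBoxResolutionsE2 ∕ E1` at `.{0, 1, 1}`) — by assembling: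

* §1 **coherence is affine-local on the base** — `isAffineLocalizing_of_restrict`: an `𝒪_Y`-module `N` all of whose
  restrictions `N|_V` to affine opens (Mathlib `Scheme.Modules.restrict`) are affine-localizing is affine-localizing
  (the unit `N → (V.ι)_*(N|_V)` is bijective on sections over the opens of `V` and `(V.ι)_*(N|_V)` is
  affine-localizing, `Morphisms/ProperPushforwardCoh.isAffineLocalizing_pushforward`); `module_finite_sections_of_restrict`:
  `Γ(V, N)` is finite over `Γ(V, 𝒪_Y)` as soon as `Γ(V, N|_V)` is finite over `Γ(V, 𝒪_V)`;
* §2 `Modules/HigherDirectImageRestrictOpen` (`(𝓗ᵏ Rf_*(F[0]))|_V ≅ 𝓗ᵏ R(f ∣_ V)_*((F|)[0])`, Hartshorne III 8.2) and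
  `Morphisms/ProperHigherDirectImagesAffine` (over the affine noetherian `V`: affine-localizing, and `Γ(V, –)` finite —
  Görtz–Wedhorn II 23.17 over `Spec Γ(V, 𝒪_Y)` through `…ProperCoherentCohomologyFiniteOverRing`);
* **`Grothendieck_higherDirectImage_coh_holds : Grothendieck_higherDirectImage_coh.{0, w, w'}`**.

Everything PROVED; 0 named facts; no instances; net named-fact debt `−1` at `u = 0` (the `.{u, w, w'}`-general form is
owed only to the `Scheme.{0}` pin of `Motives/CechCoverOrderedSections`, see `…FiniteOverRing`; no consumer needs it).
Typed for the cell `pub-hodge-ring2` (declared fact [GS] of the (m-a′) model road of crux 26512); a research route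
conditional on HC_CM, not a corollary — nothing in this file refers to it.

## References

* A. Grothendieck, J. Dieudonné, EGA III (Publ. Math. IHÉS 11, 1961), Thm. 3.2.1. [EGAIII1]
* U. Görtz, T. Wedhorn, *Algebraic Geometry II* (2023), Thm. 23.17, Cor. 23.18 (pp. 424–425). [GortzWedhorn2023]
* R. Hartshorne, *Algebraic Geometry*, GTM 52 (1977), II Prop. 5.4, III Cor. 8.2, III Thm. 8.8 (b) (p. 252). [Hartshorne1977]
* The Stacks Project, Tag 02O5. [StacksProject]
-/

noncomputable section

-- `TopCat.Presheaf`/`Scheme.Modules` are not reducible (as in Mathlib's `AlgebraicGeometry/Modules/Sheaf.lean`).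
set_option backward.isDefEq.respectTransparency false

open CategoryTheory CategoryTheory.Limits AlgebraicGeometry TopologicalSpace Opposite
open AlgebraicGeometry.Scheme.Modules

universe w w' u

namespace Literature.AlgebraicGeometry.Morphisms

open Literature.AlgebraicGeometry.Modules

/-! ## §1 Coherence is affine-local on the base -/

section Local

variable {Y : Scheme.{u}} (N : Y.Modules)

/-- Restriction between two opens each contained in the other is bijective on sections. [cite: Hartshorne1977, II §1 (sheaves)] -/
theorem bijective_presheaf_map_of_le_of_le {U U' : Y.Opens} (h : U' ≤ U) (h' : U ≤ U') :
    Function.Bijective (N.presheaf.map (homOfLE h).op) := by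
  have h1 : ∀ x : Γ(N, U), N.presheaf.map (homOfLE h').op (N.presheaf.map (homOfLE h).op x) = x := fun x => by
    rw [← CategoryTheory.comp_apply, ← Functor.map_comp,
      show (homOfLE h).op ≫ (homOfLE h').op = 𝟙 (op U) from Subsingleton.elim _ _, N.presheaf.map_id]
    rfl
  have h2 : ∀ y : Γ(N, U'), N.presheaf.map (homOfLE h).op (N.presheaf.map (homOfLE h').op y) = y := fun y => by
    rw [← CategoryTheory.comp_apply, ← Functor.map_comp,
      show (homOfLE h').op ≫ (homOfLE h).op = 𝟙 (op U') from Subsingleton.elim _ _, N.presheaf.map_id]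
    rfl
  exact ⟨fun a b hab => by rw [← h1 a, ← h1 b, hab], fun y => ⟨_, h2 y⟩⟩

/-- The unit `N → (V.ι)_*(N|_V)` of the restriction adjunction, typed. [cite: Hartshorne1977, II Prop. 5.4 (p. 113)] -/
abbrev restrictUnit (V : Y.Opens) : N ⟶ (pushforward V.ι).obj (N.restrict V.ι) :=
  (restrictAdjunction V.ι).unit.app N

/-- The unit `N → (V.ι)_*(N|_V)` is bijective on the sections over an open `U ⊆ V` (it is the restriction map of
`N` along `V.ι(V.ι⁻¹U) = U`). [cite: Hartshorne1977, II Prop. 5.4 (p. 113)] -/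
theorem bijective_restrictUnit_app (V : Y.Opens) {U : Y.Opens} (hU : U ≤ V) :
    Function.Bijective ((restrictUnit N V).app U) := by
  have e : V.ι ''ᵁ (V.ι ⁻¹ᵁ U) = U := by
    rw [Scheme.Hom.image_preimage_eq_opensRange_inf, Scheme.Opens.opensRange_ι, inf_eq_right.mpr hU]
  have h : Scheme.Modules.Hom.app (restrictUnit N V) U = N.presheaf.map (homOfLE (V.ι.image_preimage_le U)).op :=
    restrictAdjunction_unit_app_app V.ι N U
  rw [h]
  exact bijective_presheaf_map_of_le_of_le N _ e.ge

/-- **Quasi-coherence is affine-local on the base**: if every restriction `N|_V` of `N` to an affine open `V` of the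
locally noetherian scheme `Y` is affine-localizing, then `N` is affine-localizing — numerators and torsion on `V` are
read off through the unit `N → (V.ι)_*(N|_V)`, bijective over the opens of `V`, and `(V.ι)_*(N|_V)` is affine-localizing
(`Morphisms/ProperPushforwardCoh.isAffineLocalizing_pushforward`). [cite: Hartshorne1977, II Prop. 5.4 (p. 113)] -/
theorem isAffineLocalizing_of_restrict [IsLocallyNoetherian Y]
    (h : ∀ ⦃V : Y.Opens⦄, IsAffineOpen V → IsAffineLocalizing (N.restrict V.ι)) : IsAffineLocalizing N := by
  -- the affine-localizing module `(V.ι)_*(N|_V)`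
  have hN' : ∀ ⦃V : Y.Opens⦄, IsAffineOpen V →
      IsAffineLocalizing ((pushforward V.ι).obj (N.restrict V.ι)) := fun V hV => by
    haveI : IsAffine (V : Scheme.{u}) := hV
    haveI : CompactSpace (V : Scheme.{u}) := isCompact_iff_compactSpace.mp hV.isCompact
    haveI : IsNoetherian (V : Scheme.{u}) := ⟨⟩
    exact isAffineLocalizing_pushforward V.ι (h hV)
  constructor
  · intro V hV r W hW s
    have hWV : W ≤ V := hW.trans_le (Y.basicOpen_le r)
    obtain ⟨n, x', hx'⟩ := (hN' hV).numerator hV r hW ((restrictUnit N V).app W s)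
    obtain ⟨x, rfl⟩ := (bijective_restrictUnit_app N V le_rfl).2 x'
    refine ⟨n, x, (bijective_restrictUnit_app N V hWV).1 ?_⟩
    rw [Scheme.Modules.Hom.app_smul, ← hx']
    exact (map_app (restrictUnit N V) _ x).symm
  · intro V hV r x W hWV hrW hx
    have h0 : ((pushforward V.ι).obj (N.restrict V.ι)).presheaf.map (homOfLE hWV).op ((restrictUnit N V).app V x) = 0 := by
      rw [map_app (restrictUnit N V) hWV x, hx, map_zero]
    obtain ⟨n, hn⟩ := (hN' hV).torsion hV r ((restrictUnit N V).app V x) hWV hrW h0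
    refine ⟨n, (bijective_restrictUnit_app N V le_rfl).1 ?_⟩
    rw [Scheme.Modules.Hom.app_smul, hn, map_zero]

/-- **Finite type descends from the restriction**: for an affine open `V` of `Y`, `Γ(V, N)` is a finite
`Γ(V, 𝒪_Y)`-module as soon as `Γ(V, N|_V)` is a finite `Γ(V, 𝒪_V)`-module (the unit identifies `Γ(V, N)` with
`Γ(V.ι⁻¹V, N|_V) = Γ(⊤, N|_V)`, and `Γ(V, 𝒪_Y) → Γ(V.ι⁻¹V, 𝒪_V)` is an isomorphism). [cite: Hartshorne1977, II Prop. 5.4 (p. 113)] -/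
theorem module_finite_sections_of_restrict {V : Y.Opens}
    (hfin : Module.Finite Γ((V : Scheme.{u}), (⊤ : (V : Scheme.{u}).Opens)) Γ(N.restrict V.ι, ⊤)) :
    Module.Finite Γ(Y, V) Γ(N, V) := by
  -- move `⊤` to `V.ι⁻¹V`
  have hfin' : Module.Finite Γ((V : Scheme.{u}), V.ι ⁻¹ᵁ V) Γ(N.restrict V.ι, V.ι ⁻¹ᵁ V) := by
    rw [Scheme.Opens.ι_preimage_self]; exact hfin
  -- `Γ(V, (V.ι)_*(N|_V)) = Γ(V.ι⁻¹V, N|_V)` is finite over `Γ(V, 𝒪_Y)` acting through the bijective `V.ι♯`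
  haveI := Scheme.Hom.isIso_app V.ι V (by rw [Scheme.Opens.opensRange_ι])
  letI : Algebra Γ(Y, V) Γ((V : Scheme.{u}), V.ι ⁻¹ᵁ V) := (V.ι.app V).hom.toAlgebra
  haveI : Module.Finite Γ(Y, V) Γ((V : Scheme.{u}), V.ι ⁻¹ᵁ V) :=
    Module.Finite.of_surjective (Algebra.linearMap Γ(Y, V) Γ((V : Scheme.{u}), V.ι ⁻¹ᵁ V))
      (ConcreteCategory.bijective_of_isIso (V.ι.app V)).2
  letI : Module Γ((V : Scheme.{u}), V.ι ⁻¹ᵁ V) Γ((pushforward V.ι).obj (N.restrict V.ι), V) :=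
    inferInstanceAs (Module Γ((V : Scheme.{u}), V.ι ⁻¹ᵁ V) Γ(N.restrict V.ι, V.ι ⁻¹ᵁ V))
  haveI : Module.Finite Γ((V : Scheme.{u}), V.ι ⁻¹ᵁ V) Γ((pushforward V.ι).obj (N.restrict V.ι), V) := hfin'
  haveI : IsScalarTower Γ(Y, V) Γ((V : Scheme.{u}), V.ι ⁻¹ᵁ V) Γ((pushforward V.ι).obj (N.restrict V.ι), V) :=
    ⟨fun t a m => mul_smul ((V.ι.app V) t) a m⟩
  have h₁ : Module.Finite Γ(Y, V) Γ((pushforward V.ι).obj (N.restrict V.ι), V) :=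
    Module.Finite.trans Γ((V : Scheme.{u}), V.ι ⁻¹ᵁ V) Γ((pushforward V.ι).obj (N.restrict V.ι), V)
  -- and the unit `Γ(V, N) → Γ(V, (V.ι)_*(N|_V))` is a linear bijection
  exact Module.Finite.equiv
    (LinearEquiv.ofBijective (appLinear (restrictUnit N V) V) (bijective_restrictUnit_app N V le_rfl)).symm

end Local

/-! ## §2 EGA III 3.2.1 -/

/-- **Grothendieck's coherence theorem for higher direct images (EGA III Thm. 3.2.1; Görtz–Wedhorn II Thm. 23.17;
Hartshorne III Thm. 8.8 (b)) — the named fact `Grothendieck_higherDirectImage_coh` HOLDS at scheme universe `0`**: for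
`f : X → Y` proper, `Y` locally noetherian, `𝓕` coherent, arbitrary derived-category instances and every `k`, the
cohomology sheaf `𝓗ᵏ(Rf_*(𝓕[0]))` is coherent. Proof: for an affine open `V ⊆ Y`, `(𝓗ᵏ Rf_*(𝓕[0]))|_V ≅
𝓗ᵏ R(f ∣_ V)_*((𝓕|_{f⁻¹V})[0])` (`Modules/HigherDirectImageRestrictOpen`), which over the affine noetherian `V` is
affine-localizing with finitely generated global sections (`Morphisms/ProperHigherDirectImagesAffine`: ordered Čech
model, `Modules/HomologySheafSections`, Görtz–Wedhorn II Cor. 23.18 over `Spec Γ(V, 𝒪_Y)`); coherence is affine-local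
(§1). [cite: EGAIII1, Thm. 3.2.1] [cite: GortzWedhorn2023, Thm. 23.17 (p. 424)] [cite: Hartshorne1977, III Thm. 8.8 (b) (p. 252)]
[cite: StacksProject, Tag 02O5] -/
theorem Grothendieck_higherDirectImage_coh_holds : Grothendieck_higherDirectImage_coh.{0, w, w'} := by
  intro X Y f _ _ F hF _ _ k
  -- the local data on an affine open `V`
  have key : ∀ ⦃V : Y.Opens⦄, IsAffineOpen V →
      IsAffineLocalizing ((((DerivedCategory.Plus.homologyFunctor Y.Modules k).obj
        ((derivedPushforwardPlus f).obj ((DerivedCategory.Plus.singleFunctor X.Modules 0).obj F))).restrict V.ι)) ∧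
      Module.Finite Γ((V : Scheme.{0}), (⊤ : (V : Scheme.{0}).Opens))
        Γ((((DerivedCategory.Plus.homologyFunctor Y.Modules k).obj
          ((derivedPushforwardPlus f).obj ((DerivedCategory.Plus.singleFunctor X.Modules 0).obj F))).restrict V.ι), ⊤) := by
    intro V hV
    haveI : IsAffine (V : Scheme.{0}) := hV
    letI := HasDerivedCategory.standard (↑(f ⁻¹ᵁ V) : Scheme.{0}).Modules
    letI := HasDerivedCategory.standard (V : Scheme.{0}).Modules
    obtain ⟨e⟩ := nonempty_homology_derivedPushforwardPlus_single_restrict_iso f V F k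
    have hFV : Coh (F.restrict (f ⁻¹ᵁ V).ι) := coh_restrict _ F hF
    refine ⟨IsAffineLocalizing.of_iso e.symm
      (isAffineLocalizing_homology_derivedPushforwardPlus_single_of_isAffine (f ∣_ V) _ hFV k), ?_⟩
    haveI := module_finite_sections_top_homology_derivedPushforwardPlus_single (f ∣_ V) _ hFV k
    exact Module.Finite.of_surjective (appLinear e.inv ⊤) fun x => ⟨e.hom.app ⊤ x, inv_app_hom_app e ⊤ x⟩
  exact ⟨isAffineLocalizing_of_restrict _ (fun V hV => (key hV).1),
    fun V hV => module_finite_sections_of_restrict _ (key hV).2⟩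

end Literature.AlgebraicGeometry.Morphisms

end
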